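import Summits.Ventures.PercRepro.RankLevelSetLevelTenGXTBFormZA
import Summits.Ventures.PercRepro.RankLevelSetLevelTenGXTBFormZB
import Summits.Ventures.PercRepro.RankLevelSetLevelTenGXTBFormZC
import Summits.Ventures.PercRepro.RankLevelSetLevelTenGXTBFormZD
import Summits.Ventures.PercRepro.RankLevelSetLevelTenGXTBFormZE
import Summits.Ventures.PercRepro.RankLevelSetLevelTenGXTBFormZF
import Summits.Ventures.PercRepro.RankLevelSetLevelTenGXTBFormZG
import Summits.Ventures.PercRepro.RankLevelSetLevelTenGXTBFormZH
import Summits.Ventures.PercRepro.RankLevelSetLevelTenGXTBFormZI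

/-!
# PercRepro — THE LEVEL-`10` DISPATCHER OF THE GXT CHAIN (THE GIANT-EXACT COUNT WITH LEMMA T5) AT BASE `403`: the per-corank form
`(c₁, c₂)`, `(P_d^gxtb)` and the `Y`-tail for `11 ≤ d ≤ 726` (p2, gen 35; a feeder for S4 — the top of the `q = 10` window, from
`1,088`). The nine parts ZA … ZI (the second level-10 chain, base 403 = the flat-cell floor; the base-430 chain is RankLevelSetLevelTenGXTForm). Axioms: standard.
-/

set_option exponentiation.threshold 4096

namespace PercRepro

namespace ThmN

/-- **THE PER-CORANK FORM OF THE LEVEL-`10` GXT CHAIN AT BASE `403`**: for every corank `11 ≤ d ≤ 726`, every `p ≥ 403` and every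
`n ≥ 403 + d` there are `0 < c₂ < c₁` with the certificate `c₁·(C(n,10) + σ_m·Π_E′ + 2^{min 639 (10+d)}) ≤ c₂·2^{d−10}·C(p+10, 10)` and
the tail `c₁·G₁₀(d, n) ≤ (c₁ − c₂)·2^n` (the form `(c₁, c₂)` of every corank in FORMS10GXTB_403.txt, lane tools/; LEMMA T5 in `Π_E`). -/
theorem gxtb_form_ten (d : ℕ) (hd1 : 11 ≤ d) (hd2 : d ≤ 726) (p : ℕ) (hp : 403 ≤ p) (n : ℕ) (hn : 403 + d ≤ n) :
    ∃ c₁ c₂ : ℕ, 0 < c₂ ∧ c₂ < c₁ ∧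
    ((c₁ : ℕ) : ℚ) * ((((p + d).choose 10 : ℕ) : ℚ) + (∑ j ∈ Finset.range (d - 10), ((Nat.choose (min 628 (max ((d + min 310 d) / 2 + 1) (min 309 (d - 1) + 2) - 2)) j : ℕ) : ℚ) / (((j + 1) + 3 * (j + 1).choose 2 + 3 * (j + 1).choose 3 + 2 * (j + 1).choose 4 : ℕ) : ℚ)) *
      (((d * (d + 1) / 2 : ℕ) : ℚ) * ((p + d).choose 8 : ℚ) + ((d * (d + 1) * (d + 2) / 3 : ℕ) : ℚ) * ((p + d).choose 7 : ℚ) + ((7 * d * (d + 1) * (d + 2) * (d + 3) / 48 : ℕ) : ℚ) * ((p + d).choose 6 : ℚ) + (((d + 5).choose 6 : ℕ) : ℚ) * ((p + d).choose 5 : ℚ) + (((d + 6).choose 7 : ℕ) : ℚ) * ((p + d).choose 4 : ℚ) + (((d + 7).choose 8 : ℕ) : ℚ) * ((p + d).choose 3 : ℚ) + (((d + 8).choose 9 : ℕ) : ℚ) * ((p + d).choose 2 : ℚ) + (((d + 9).choose 10 : ℕ) : ℚ) * (p + d : ℚ) + (((d + 10).choose 11 : ℕ) : ℚ)) +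
      (2 : ℚ) ^ (min 639 (10 + d))) ≤
      ((c₂ : ℕ) : ℚ) * 2 ^ (d - 10) * (((p + 10).choose 10 : ℕ) : ℚ) ∧
      c₁ * (n.choose 10 * 2 ^ (min 629 d) + n.choose 9 * 2 ^ 310 + n.choose 8 * 2 ^ 151 + n.choose 7 * 2 ^ 72 + n.choose 6 * 2 ^ 33 + n.choose 5 * 2 ^ 14 + n.choose 4 * 2 ^ 6 + n.choose 3 * 2 ^ 3 + n.choose 2 * 2 + n + 1 + ∑ j ∈ Finset.range (d + 1), n.choose j) ≤ (c₁ - c₂) * 2 ^ n := by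
  rcases Nat.lt_or_ge d (90 + 1) with h0 | h0
  · exact gxtb_form_ten_ZA d hd1 (by omega) p hp n hn
  rcases Nat.lt_or_ge d (170 + 1) with h1 | h1
  · exact gxtb_form_ten_ZB d (by omega) (by omega) p hp n hn
  rcases Nat.lt_or_ge d (250 + 1) with h2 | h2
  · exact gxtb_form_ten_ZC d (by omega) (by omega) p hp n hn
  rcases Nat.lt_or_ge d (330 + 1) with h3 | h3
  · exact gxtb_form_ten_ZD d (by omega) (by omega) p hp n hn
  rcases Nat.lt_or_ge d (410 + 1) with h4 | h4
  · exact gxtb_form_ten_ZE d (by omega) (by omega) p hp n hn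
  rcases Nat.lt_or_ge d (490 + 1) with h5 | h5
  · exact gxtb_form_ten_ZF d (by omega) (by omega) p hp n hn
  rcases Nat.lt_or_ge d (570 + 1) with h6 | h6
  · exact gxtb_form_ten_ZG d (by omega) (by omega) p hp n hn
  rcases Nat.lt_or_ge d (650 + 1) with h7 | h7
  · exact gxtb_form_ten_ZH d (by omega) (by omega) p hp n hn
  · exact gxtb_form_ten_ZI d (by omega) hd2 p hp n hn

end ThmN

end PercRepro
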